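import Summits.Ventures.LatticeQCDFlow.Exactness.IMHCommonRandomNumbersMeetingTimeAnyCoupling
import Summits.Ventures.LatticeQCDFlow.Exactness.IMHCommonRandomNumbersMeetingTimeTwoStartsAtoms
import HarnessLib

/-!
# The any-coupling law of the meeting time WITH ATOMS: for EVERY proposal law (finite gauge groups included) and every initial coupling,
# `P(X_n ≠ X′_n) = E[(1 − A(heavier start))ⁿ; X_0 ≠ X′_0]` and `Σ_n P(X_n ≠ X′_n) = E[1/A(heavier start); X_0 ≠ X′_0]`

HONEST FRAMING: exact (Metropolis-corrected) sampling algorithms for lattice gauge theory;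
figures of merit are autocorrelation/cost numbers at stated couplings and volumes; no
continuum-physics claim.

Venture `LatticeQCDFlow` (cell pub-lqcd), topic `Exactness`; FANOUT row 30 (lean-1, GEN-40).  NEW WORK of the cell (standard Borel `Ω`,
`MeasurableEq Ω`); GEN-39's `Exactness/IMHCommonRandomNumbersMeetingTimeAnyCoupling` WITHOUT ITS ATOM-FREE HYPOTHESIS `q{x} = 0`, by
substituting this generation's two-starts law with atoms (`…TwoStartsAtoms`: from an ordered off-diagonal pair the runs still differ after one
update exactly when the heavier run rejects) for GEN-39's atom-free one inside GEN-39's own linearity ∕ disintegration ∕ swap argument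
(GEN-39's §1 lemmas `iterate_bind_add`, `iterate_bind_comp`, `iterate_bind_crnPair_offDiagonal_eq_zero_of_diag`, `iterate_bind_crnPair_swap`
are imported, its §2–§5 re-proved verbatim up to that substitution).  Consequence: this generation's unbounded-weight files
(`…MeetingTimeUnboundedWeights`, `…EveryStartRateUnboundedWeights`, `…CoupledUnbiasedEstimatorUnboundedWeights`, `…SecondMomentSharp`, …) build
on THIS file and carry no atom-freeness hypothesis — the coupling theory holds for purely atomic proposals, i.e. for finite gauge groups.
Setting: CRN pair kernel `K̂` of `K = indepMH q w`
(`0 < w` measurable), `A = imhAcceptMass q w`, `O = {p | w p.2 ≤ w p.1}` (first run heavier or equal), `Δ` the diagonal: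

* §1 **`iterate_bind_crnPair_offDiagonal_eq_mixture_atoms`** — ordered random start `μ̂₀ = μ₁ ⊗ₘ κ` (`κ x` carried by the lighter-or-equal
  configurations and by `{x}ᶜ`, `μ₁`-a.e.): `P(X_n ≠ X′_n) = ∫ (1 − A(x))ⁿ dμ₁(x)`, every `q`.
* §2 **`iterate_bind_crnPair_offDiagonal_eq_lintegral_fst_atoms`** — a finite `ρ` carried by `O ∩ Δᶜ`: `(ρK̂ⁿ)(Δᶜ) = ∫ (1 − A(p.1))ⁿ dρ`;
  **`iterate_bind_crnPair_offDiagonal_eq_anyCoupling_atoms`** — EVERY finite `μ̂₀`: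
  `(μ̂₀K̂ⁿ)(Δᶜ) = ∫_{O ∩ Δᶜ} (1 − A(p.1))ⁿ dμ̂₀ + ∫_{Oᶜ ∩ Δᶜ} (1 − A(p.2))ⁿ dμ̂₀`.
* §3 **`tsum_iterate_bind_crnPair_offDiagonal_eq_anyCoupling_atoms`** — `Σ_n (μ̂₀K̂ⁿ)(Δᶜ) = ∫_{O ∩ Δᶜ} A(p.1)⁻¹ dμ̂₀ + ∫_{Oᶜ ∩ Δᶜ} A(p.2)⁻¹ dμ̂₀`:
  THE EXPECTED TOTAL DISAGREEMENT TIME IS THE MEAN INVERSE ACCEPTANCE AT THE HEAVIER START, FOR EVERY PROPOSAL LAW AND EVERY COUPLING.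
Reading (gauge files): for two exact samplers of ANY gauge group — finite or Lie — on one stream of random numbers from any pair of starting
laws, the number of updates on which they differ is a mixture of geometric laws with parameter the acceptance at the heavier start.
NOT CLAIMED: the real-valued `E[T]` and tail corollaries of GEN-39 §4–§5 with a mode (they follow verbatim; not re-typed).  No `sorry`, no new definitions, nothing cited as a fact.
-/

noncomputable section

namespace Summit.Ventures.LatticeQCDFlow.Exactness

open MeasureTheory ProbabilityTheory Function Finset Filter Set
open scoped _root_.ENNReal unitInterval Topology
open Summit.Ventures.LatticeQCDFlow.Scoring

variable {Ω : Type*} [MeasurableSpace Ω] {q : Measure Ω} [IsProbabilityMeasure q] {w : Ω → ℝ}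

/-! ## §1 Ordered random start: a mixture of geometric laws, with atoms -/

/-- **ORDERED RANDOM START, EVERY PROPOSAL LAW**: `μ̂₀ = μ₁ ⊗ₘ κ` with, for `μ₁`-a.e. `x`, `κ x` carried by the lighter-or-equal configurations
and `κ x {x} = 0`.  Then `P(X_n ≠ X′_n) = ∫ (1 − A(x))ⁿ dμ₁(x)` EXACTLY, every `n`. [ours] -/
theorem iterate_bind_crnPair_offDiagonal_eq_mixture_atoms [MeasurableSingletonClass Ω] [MeasurableEq Ω] (hw : Measurable w)
    (hw0 : ∀ y, 0 < w y) (Khat : Kernel (Ω × Ω) (Ω × Ω)) [IsMarkovKernel Khat]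
    (hK : ∀ z : Ω × Ω, Khat z = (q.prod (volume : Measure unitInterval)).map (fun p : Ω × unitInterval =>
      ((if (p.2 : ℝ) * w z.1 ≤ w p.1 then p.1 else z.1), (if (p.2 : ℝ) * w z.2 ≤ w p.1 then p.1 else z.2))))
    (n : ℕ) (μ₁ : Measure Ω) [SFinite μ₁] (κ : Kernel Ω Ω) [IsMarkovKernel κ]
    (hκord : ∀ᵐ x ∂μ₁, κ x {y | w y ≤ w x} = 1) (hκx : ∀ᵐ x ∂μ₁, κ x {x} = 0) :
    ((fun m : Measure (Ω × Ω) => m.bind Khat)^[n] (μ₁ ⊗ₘ κ)) (Set.diagonal Ω)ᶜ = ∫⁻ x, (1 - imhAcceptMass q w x) ^ n ∂μ₁ := by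
  have hD : MeasurableSet (Set.diagonal Ω)ᶜ := (measurableSet_diagonal (α := Ω)).compl
  rw [Measure.compProd_eq_comp_prod, iterate_bind_comp Khat n (Kernel.id ×ₖ κ) μ₁, Measure.bind_apply hD (Kernel.aemeasurable _)]
  refine lintegral_congr_ae ?_
  filter_upwards [hκord, hκx] with x hx1 hx2
  rw [iterate_comp_apply Khat (Kernel.id ×ₖ κ) n x, Kernel.prod_apply, Kernel.id_apply, Measure.dirac_prod]
  haveI : IsProbabilityMeasure ((κ x).map (Prod.mk x)) := Measure.isProbabilityMeasure_map measurable_prodMk_left.aemeasurable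
  have hfst : ((κ x).map (Prod.mk x)).map Prod.fst = Measure.dirac x := by
    rw [Measure.map_map measurable_fst measurable_prodMk_left]
    show (κ x).map (fun _ => x) = Measure.dirac x
    rw [Measure.map_const, measure_univ, one_smul]
  have hord : ((κ x).map (Prod.mk x)) {p : Ω × Ω | w p.2 ≤ w p.1} = 1 := by
    have hOm : MeasurableSet {p : Ω × Ω | w p.2 ≤ w p.1} := measurableSet_le (hw.comp measurable_snd) (hw.comp measurable_fst)
    rw [Measure.map_apply measurable_prodMk_left hOm]
    exact hx1
  have hsnd : (((κ x).map (Prod.mk x)).map Prod.snd) {x}ᶜ = 1 := by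
    rw [Measure.map_map measurable_snd measurable_prodMk_left]
    have hid : (Prod.snd ∘ Prod.mk x : Ω → Ω) = id := rfl
    rw [hid, Measure.map_id, ← prob_add_prob_compl (μ := κ x) (measurableSet_singleton x), hx2, zero_add]
  rw [iterate_bind_crnPair_offDiagonal_eq_holding_atoms' hw hw0 Khat hK n ((κ x).map (Prod.mk x)) hfst hord, hsnd, mul_one]

/-! ## §2 Every initial coupling, with atoms -/

/-- **A FINITE MEASURE ON PAIRS CARRIED BY THE ORDERED OFF-DIAGONAL SET, EVERY PROPOSAL LAW**: `ρ(Δ) = 0`, `ρ(Oᶜ) = 0` (standard Borel) ⇒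
`(ρK̂ⁿ)(Δᶜ) = ∫ (1 − A(p.1))ⁿ dρ(p)`. [ours] -/
theorem iterate_bind_crnPair_offDiagonal_eq_lintegral_fst_atoms [StandardBorelSpace Ω] [Nonempty Ω] [MeasurableSingletonClass Ω]
    [MeasurableEq Ω] (hw : Measurable w) (hw0 : ∀ y, 0 < w y) (Khat : Kernel (Ω × Ω) (Ω × Ω)) [IsMarkovKernel Khat]
    (hK : ∀ z : Ω × Ω, Khat z = (q.prod (volume : Measure unitInterval)).map (fun p : Ω × unitInterval =>
      ((if (p.2 : ℝ) * w z.1 ≤ w p.1 then p.1 else z.1), (if (p.2 : ℝ) * w z.2 ≤ w p.1 then p.1 else z.2))))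
    (n : ℕ) (ρ : Measure (Ω × Ω)) [IsFiniteMeasure ρ] (hΔ : ρ (Set.diagonal Ω) = 0) (hO : ρ {p : Ω × Ω | w p.2 ≤ w p.1}ᶜ = 0) :
    ((fun m : Measure (Ω × Ω) => m.bind Khat)^[n] ρ) (Set.diagonal Ω)ᶜ = ∫⁻ p, (1 - imhAcceptMass q w p.1) ^ n ∂ρ := by
  have hOm : MeasurableSet {p : Ω × Ω | w p.2 ≤ w p.1} := measurableSet_le (hw.comp measurable_snd) (hw.comp measurable_fst)
  have hAm : Measurable fun x : Ω => (1 - imhAcceptMass q w x) ^ n := (measurable_const.sub (measurable_imhAcceptMass q hw)).pow_const n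
  have hdis : ρ.fst ⊗ₘ ρ.condKernel = ρ := ρ.disintegrate ρ.condKernel
  have hκord : ∀ᵐ x ∂ρ.fst, ρ.condKernel x {y | w y ≤ w x} = 1 := by
    have h0 : ∫⁻ x, ρ.condKernel x (Prod.mk x ⁻¹' {p : Ω × Ω | w p.2 ≤ w p.1}ᶜ) ∂ρ.fst = 0 := by
      rw [← Measure.compProd_apply hOm.compl, hdis]; exact hO
    have hae := (lintegral_eq_zero_iff (Kernel.measurable_kernel_prodMk_left hOm.compl)).1 h0
    filter_upwards [hae] with x hx
    have hx' : ρ.condKernel x {y | w y ≤ w x}ᶜ = 0 := hx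
    rw [← prob_add_prob_compl (μ := ρ.condKernel x) (measurableSet_le hw measurable_const : MeasurableSet {y | w y ≤ w x}), hx', add_zero]
  have hκx : ∀ᵐ x ∂ρ.fst, ρ.condKernel x {x} = 0 := by
    have h0 : ∫⁻ x, ρ.condKernel x (Prod.mk x ⁻¹' Set.diagonal Ω) ∂ρ.fst = 0 := by
      rw [← Measure.compProd_apply (measurableSet_diagonal (α := Ω)), hdis]; exact hΔ
    have hae := (lintegral_eq_zero_iff (Kernel.measurable_kernel_prodMk_left (measurableSet_diagonal (α := Ω)))).1 h0
    filter_upwards [hae] with x hx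
    have hset : Prod.mk x ⁻¹' Set.diagonal Ω = {x} := by
      ext y; simp [Set.mem_diagonal_iff, eq_comm]
    rw [← hset]; exact hx
  have hL : ((fun m : Measure (Ω × Ω) => m.bind Khat)^[n] ρ) (Set.diagonal Ω)ᶜ =
      ((fun m : Measure (Ω × Ω) => m.bind Khat)^[n] (ρ.fst ⊗ₘ ρ.condKernel)) (Set.diagonal Ω)ᶜ := by rw [hdis]
  rw [hL, iterate_bind_crnPair_offDiagonal_eq_mixture_atoms hw hw0 Khat hK n ρ.fst ρ.condKernel hκord hκx, Measure.fst,
    lintegral_map hAm measurable_fst]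

/-- **THE EXACT ONE-TIME DISAGREEMENT PROBABILITY FROM EVERY INITIAL COUPLING, EVERY PROPOSAL LAW**: standard Borel `Ω`; for every finite
measure `μ̂₀` on pairs and every `n`, `(μ̂₀K̂ⁿ)(Δᶜ) = ∫_{O ∩ Δᶜ} (1 − A(p.1))ⁿ dμ̂₀ + ∫_{Oᶜ ∩ Δᶜ} (1 − A(p.2))ⁿ dμ̂₀`. [ours] -/
theorem iterate_bind_crnPair_offDiagonal_eq_anyCoupling_atoms [StandardBorelSpace Ω] [Nonempty Ω] [MeasurableSingletonClass Ω]
    [MeasurableEq Ω] (hw : Measurable w) (hw0 : ∀ y, 0 < w y) (Khat : Kernel (Ω × Ω) (Ω × Ω)) [IsMarkovKernel Khat]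
    (hK : ∀ z : Ω × Ω, Khat z = (q.prod (volume : Measure unitInterval)).map (fun p : Ω × unitInterval =>
      ((if (p.2 : ℝ) * w z.1 ≤ w p.1 then p.1 else z.1), (if (p.2 : ℝ) * w z.2 ≤ w p.1 then p.1 else z.2))))
    (n : ℕ) (μ₀ : Measure (Ω × Ω)) [IsFiniteMeasure μ₀] :
    ((fun m : Measure (Ω × Ω) => m.bind Khat)^[n] μ₀) (Set.diagonal Ω)ᶜ =
      ∫⁻ p in {p : Ω × Ω | w p.2 ≤ w p.1} ∩ (Set.diagonal Ω)ᶜ, (1 - imhAcceptMass q w p.1) ^ n ∂μ₀ +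
        ∫⁻ p in {p : Ω × Ω | w p.2 ≤ w p.1}ᶜ ∩ (Set.diagonal Ω)ᶜ, (1 - imhAcceptMass q w p.2) ^ n ∂μ₀ := by
  have hD : MeasurableSet (Set.diagonal Ω) := measurableSet_diagonal
  have hOm : MeasurableSet {p : Ω × Ω | w p.2 ≤ w p.1} := measurableSet_le (hw.comp measurable_snd) (hw.comp measurable_fst)
  have hAm : Measurable fun x : Ω => (1 - imhAcceptMass q w x) ^ n := (measurable_const.sub (measurable_imhAcceptMass q hw)).pow_const n
  have hsplit : μ₀ = μ₀.restrict (Set.diagonal Ω) +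
      (μ₀.restrict ({p : Ω × Ω | w p.2 ≤ w p.1} ∩ (Set.diagonal Ω)ᶜ) + μ₀.restrict ({p : Ω × Ω | w p.2 ≤ w p.1}ᶜ ∩ (Set.diagonal Ω)ᶜ)) := by
    rw [← Measure.restrict_restrict hOm, ← Measure.restrict_restrict hOm.compl, Measure.restrict_add_restrict_compl hOm,
      Measure.restrict_add_restrict_compl hD]
  have h1 : ((fun m : Measure (Ω × Ω) => m.bind Khat)^[n] (μ₀.restrict (Set.diagonal Ω))) (Set.diagonal Ω)ᶜ = 0 :=
    iterate_bind_crnPair_offDiagonal_eq_zero_of_diag hw hw0 Khat hK n _ (by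
      rw [Measure.restrict_apply hD.compl, Set.compl_inter_self, measure_empty])
  have h2 : ((fun m : Measure (Ω × Ω) => m.bind Khat)^[n] (μ₀.restrict ({p : Ω × Ω | w p.2 ≤ w p.1} ∩ (Set.diagonal Ω)ᶜ))) (Set.diagonal Ω)ᶜ =
      ∫⁻ p in {p : Ω × Ω | w p.2 ≤ w p.1} ∩ (Set.diagonal Ω)ᶜ, (1 - imhAcceptMass q w p.1) ^ n ∂μ₀ :=
    iterate_bind_crnPair_offDiagonal_eq_lintegral_fst_atoms hw hw0 Khat hK n _
      (by rw [Measure.restrict_apply hD]; exact measure_mono_null (fun p hp => hp.2.2 hp.1) (measure_empty (μ := μ₀)))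
      (by rw [Measure.restrict_apply hOm.compl]; exact measure_mono_null (fun p hp => hp.1 hp.2.1) (measure_empty (μ := μ₀)))
  have h3 : ((fun m : Measure (Ω × Ω) => m.bind Khat)^[n] (μ₀.restrict ({p : Ω × Ω | w p.2 ≤ w p.1}ᶜ ∩ (Set.diagonal Ω)ᶜ))) (Set.diagonal Ω)ᶜ =
      ∫⁻ p in {p : Ω × Ω | w p.2 ≤ w p.1}ᶜ ∩ (Set.diagonal Ω)ᶜ, (1 - imhAcceptMass q w p.2) ^ n ∂μ₀ := by
    set C := μ₀.restrict ({p : Ω × Ω | w p.2 ≤ w p.1}ᶜ ∩ (Set.diagonal Ω)ᶜ) with hC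
    have hpre : Prod.swap ⁻¹' (Set.diagonal Ω)ᶜ = (Set.diagonal Ω)ᶜ := by
      ext p; simp [Set.mem_diagonal_iff, eq_comm]
    have hswap : ((fun m : Measure (Ω × Ω) => m.bind Khat)^[n] C) (Set.diagonal Ω)ᶜ =
        ((fun m : Measure (Ω × Ω) => m.bind Khat)^[n] (C.map Prod.swap)) (Set.diagonal Ω)ᶜ := by
      rw [iterate_bind_crnPair_swap hw Khat hK n C, Measure.map_apply measurable_swap hD.compl, hpre]
    rw [hswap]
    have hCΔ : (C.map Prod.swap) (Set.diagonal Ω) = 0 := by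
      rw [Measure.map_apply measurable_swap hD, hC, Measure.restrict_apply (measurable_swap hD)]
      exact measure_mono_null (fun p hp => hp.2.2 (by
        have h := hp.1; rw [Set.mem_preimage, Set.mem_diagonal_iff] at h; exact Set.mem_diagonal_iff.2 h.symm)) (measure_empty (μ := μ₀))
    have hCO : (C.map Prod.swap) {p : Ω × Ω | w p.2 ≤ w p.1}ᶜ = 0 := by
      rw [Measure.map_apply measurable_swap hOm.compl, hC, Measure.restrict_apply (measurable_swap hOm.compl)]
      refine measure_mono_null (fun p hp => ?_) (measure_empty (μ := μ₀))
      have h1' : ¬ w p.1 ≤ w p.2 := hp.1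
      have h2' : ¬ w p.2 ≤ w p.1 := hp.2.1
      exact absurd (le_of_lt (not_le.1 h1')) h2'
    have hAm1 : Measurable fun p : Ω × Ω => (1 - imhAcceptMass q w p.1) ^ n := hAm.comp measurable_fst
    rw [iterate_bind_crnPair_offDiagonal_eq_lintegral_fst_atoms hw hw0 Khat hK n _ hCΔ hCO, lintegral_map hAm1 measurable_swap]
    rfl
  have hL : ((fun m : Measure (Ω × Ω) => m.bind Khat)^[n] μ₀) (Set.diagonal Ω)ᶜ =
      ((fun m : Measure (Ω × Ω) => m.bind Khat)^[n] (μ₀.restrict (Set.diagonal Ω) +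
        (μ₀.restrict ({p : Ω × Ω | w p.2 ≤ w p.1} ∩ (Set.diagonal Ω)ᶜ) +
          μ₀.restrict ({p : Ω × Ω | w p.2 ≤ w p.1}ᶜ ∩ (Set.diagonal Ω)ᶜ)))) (Set.diagonal Ω)ᶜ := by
    rw [← hsplit]
  rw [hL, iterate_bind_add Khat n, iterate_bind_add Khat n, Measure.add_apply, Measure.add_apply, h1, h2, h3, zero_add]

/-! ## §3 The expected total disagreement time from every coupling, every proposal law -/

/-- **`Σ_n P(X_n ≠ X′_n) = ∫_{O ∩ Δᶜ} A(p.1)⁻¹ dμ̂₀ + ∫_{Oᶜ ∩ Δᶜ} A(p.2)⁻¹ dμ̂₀`** in `ℝ≥0∞`, from every initial coupling, for EVERY proposal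
law (standard Borel `Ω`). [ours] -/
theorem tsum_iterate_bind_crnPair_offDiagonal_eq_anyCoupling_atoms [StandardBorelSpace Ω] [Nonempty Ω] [MeasurableSingletonClass Ω]
    [MeasurableEq Ω] (hw : Measurable w) (hw0 : ∀ y, 0 < w y) (Khat : Kernel (Ω × Ω) (Ω × Ω)) [IsMarkovKernel Khat]
    (hK : ∀ z : Ω × Ω, Khat z = (q.prod (volume : Measure unitInterval)).map (fun p : Ω × unitInterval =>
      ((if (p.2 : ℝ) * w z.1 ≤ w p.1 then p.1 else z.1), (if (p.2 : ℝ) * w z.2 ≤ w p.1 then p.1 else z.2))))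
    (μ₀ : Measure (Ω × Ω)) [IsFiniteMeasure μ₀] :
    ∑' n, ((fun m : Measure (Ω × Ω) => m.bind Khat)^[n] μ₀) (Set.diagonal Ω)ᶜ =
      ∫⁻ p in {p : Ω × Ω | w p.2 ≤ w p.1} ∩ (Set.diagonal Ω)ᶜ, (imhAcceptMass q w p.1)⁻¹ ∂μ₀ +
        ∫⁻ p in {p : Ω × Ω | w p.2 ≤ w p.1}ᶜ ∩ (Set.diagonal Ω)ᶜ, (imhAcceptMass q w p.2)⁻¹ ∂μ₀ := by
  have hAm : Measurable fun x : Ω => imhAcceptMass q w x := measurable_imhAcceptMass q hw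
  have h1 : ∀ n : ℕ, AEMeasurable (fun p : Ω × Ω => (1 - imhAcceptMass q w p.1) ^ n)
      (μ₀.restrict ({p : Ω × Ω | w p.2 ≤ w p.1} ∩ (Set.diagonal Ω)ᶜ)) := fun n =>
    ((measurable_const.sub (hAm.comp measurable_fst)).pow_const n).aemeasurable
  have h2 : ∀ n : ℕ, AEMeasurable (fun p : Ω × Ω => (1 - imhAcceptMass q w p.2) ^ n)
      (μ₀.restrict ({p : Ω × Ω | w p.2 ≤ w p.1}ᶜ ∩ (Set.diagonal Ω)ᶜ)) := fun n =>
    ((measurable_const.sub (hAm.comp measurable_snd)).pow_const n).aemeasurable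
  simp_rw [iterate_bind_crnPair_offDiagonal_eq_anyCoupling_atoms hw hw0 Khat hK _ μ₀]
  rw [ENNReal.tsum_add, ← lintegral_tsum h1, ← lintegral_tsum h2]
  congr 1
  · refine lintegral_congr fun p => ?_
    rw [ENNReal.tsum_geometric, ENNReal.sub_sub_cancel ENNReal.one_ne_top (imhAcceptMass_le_one (q := q) (w := w) p.1)]
  · refine lintegral_congr fun p => ?_
    rw [ENNReal.tsum_geometric, ENNReal.sub_sub_cancel ENNReal.one_ne_top (imhAcceptMass_le_one (q := q) (w := w) p.2)]

end Summit.Ventures.LatticeQCDFlow.Exactness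

end
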